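import Mathlib.CategoryTheory.Limits.Preserves.Shapes.Products
import Mathlib.CategoryTheory.Limits.Preserves.Shapes.Terminal
import Mathlib.CategoryTheory.Limits.Preserves.Finite
import Literature.AnabelianGeometry.SemiGraphs.GraphOfAnabelioids
import Literature.AnabelianGeometry.SemiGraphs.GraphCoveringFibres

/-!
# The object of `B(𝒢)` attached to a graph-covering of the underlying semi-graph ([SemiAnbd] §2 p. 23)

Mochizuki, *Semi-graphs of anabelioids*, Publ. RIMS **42** (2006) 221–322, §2 p. 23
[cite: MochizukiSemiAnbd2006, Def. 2.2(i) p.23] (finite étale coverings of `𝒢` "arise naturally as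
the `B(−)` of some semi-graph of anabelioids `𝒢'` … over some proper morphism of semi-graphs") and
the proof of Proposition 2.6, p. 29 ("we may construct a finite graph-covering of degree `M` …
which is trivial over `𝕂`").  For a graph-covering `ψ : 𝔾' → 𝔾` with finite fibres (`𝔾'` a graph)
the covering `𝒢 ×_𝔾 𝔾' → 𝒢` (`BaseChange.lean`) is TRIVIAL over every constituent, so the
corresponding object of `B(𝒢)` (descent datum `{S_v, T_e, ψ_b}`) is

* `S_v := ∐_{v' ↦ v} 1` in `𝒢_v`, `T_e := ∐_{e' ↦ e} 1` in `𝒢_e` (`fiberObjV`, `fiberObjE`);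
* `ψ_b : b^* S_v ⥲ T_e` the composite of `b^*(∐ 1) ≅ ∐ b^* 1 ≅ ∐ 1` (exactness of `b^*`) with the
  reindexing along the branch bijection `ψ⁻¹(v) ≃ ψ⁻¹(e)` of `GraphCoveringFibres.lean`
  (`coveringGluing`);

assembled as `coveringObj : 𝒢.BObj`.  Deliberately NOT here: that `𝒢 ×_𝔾 𝔾' → 𝒢` is the
finite étale covering attached to `coveringObj` (`Coverticial.lean`'s `IsFiniteEtaleCoveringOf`;
sequel), and the `Π_𝒢`-set of `coveringObj` (≅ the fibre `ψ⁻¹(w)` with the monodromy action).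
-/

namespace Literature.AnabelianGeometry.SemiGraphs

namespace SemiGraphOfAnabelioids

open CategoryTheory CategoryTheory.Limits

universe v₁ u₁ u

variable (𝒢 : SemiGraphOfAnabelioids.{v₁, u₁, u}) {G' : SemiGraph.{u}} (ψ : G' ⟶ 𝒢.graph)

/-- `∐_{ψ⁻¹(v)} 1` in `𝒢_v`: the vertex object over `v` of the descent datum attached to `ψ`
(the trivial covering of `𝒢_v` with sheets indexed by the fibre). [cite: MochizukiSemiAnbd2006, Def. 2.2(i) p.23] -/
noncomputable abbrev fiberObjV (v : 𝒢.graph.Vertex) [Finite (ψ.VertexFiber v)] : 𝒢.V v :=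
  ∐ fun _ : ψ.VertexFiber v => ⊤_ (𝒢.V v)

/-- `∐_{ψ⁻¹(e)} 1` in `𝒢_e`: the edge object over `e` of the descent datum attached to `ψ`.
[cite: MochizukiSemiAnbd2006, Def. 2.2(i) p.23] -/
noncomputable abbrev fiberObjE (e : 𝒢.graph.Edge) [Finite (ψ.EdgeFiber e)] : 𝒢.E e :=
  ∐ fun _ : ψ.EdgeFiber e => ⊤_ (𝒢.E e)

variable {ψ}

/-- The gluing isomorphism `ψ_b : b^* S_v ⥲ T_e` of the descent datum attached to a graph-covering:
`b^*(∐_{ψ⁻¹ v} 1) ≅ ∐_{ψ⁻¹ v} b^* 1 ≅ ∐_{ψ⁻¹ v} 1 ≅ ∐_{ψ⁻¹ e} 1`, the last step reindexing along the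
branch bijection of `b`. [cite: MochizukiSemiAnbd2006, Def. 2.2(i) p.23] -/
noncomputable def coveringGluing (hψ : SemiGraph.IsExcision ψ) (hG' : G'.IsGraph)
    (b : 𝒢.graph.Branch) (v : 𝒢.graph.Vertex) (h : 𝒢.graph.abuts b = some v)
    [Finite (ψ.VertexFiber v)] [Finite (ψ.EdgeFiber (𝒢.graph.edgeOf b))] :
    (𝒢.pull b v h).pullback.obj (𝒢.fiberObjV ψ v) ≅ 𝒢.fiberObjE ψ (𝒢.graph.edgeOf b) :=
  PreservesCoproduct.iso (𝒢.pull b v h).pullback _ ≪≫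
    Sigma.mapIso (fun _ => PreservesTerminal.iso (𝒢.pull b v h).pullback) ≪≫
      Sigma.reindex (SemiGraph.Hom.fiberEquivOfBranch hψ hG' b v h)
        (fun _ : ψ.EdgeFiber (𝒢.graph.edgeOf b) => ⊤_ (𝒢.E (𝒢.graph.edgeOf b)))

/-- **The object of `B(𝒢)` attached to a graph-covering `ψ : 𝔾' → 𝔾` with finite fibres**
(`𝔾'` a graph): sheets `∐_{fibre} 1` over every constituent, glued by the branch bijections
(p. 23; proof of Prop. 2.6 p. 29). [cite: MochizukiSemiAnbd2006, Def. 2.2(i) p.23] -/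
noncomputable def coveringObj (hψ : SemiGraph.IsExcision ψ) (hG' : G'.IsGraph)
    [∀ v, Finite (ψ.VertexFiber v)] [∀ e, Finite (ψ.EdgeFiber e)] : 𝒢.BObj where
  S v := 𝒢.fiberObjV ψ v
  T e := 𝒢.fiberObjE ψ e
  ψ b v h := 𝒢.coveringGluing hψ hG' b v h

/-- The vertex objects of `coveringObj`. [cite: MochizukiSemiAnbd2006, Def. 2.2(i) p.23] -/
@[simp] theorem coveringObj_S (hψ : SemiGraph.IsExcision ψ) (hG' : G'.IsGraph)
    [∀ v, Finite (ψ.VertexFiber v)] [∀ e, Finite (ψ.EdgeFiber e)] (v : 𝒢.graph.Vertex) :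
    (𝒢.coveringObj hψ hG').S v = 𝒢.fiberObjV ψ v := rfl

/-- The edge objects of `coveringObj`. [cite: MochizukiSemiAnbd2006, Def. 2.2(i) p.23] -/
@[simp] theorem coveringObj_T (hψ : SemiGraph.IsExcision ψ) (hG' : G'.IsGraph)
    [∀ v, Finite (ψ.VertexFiber v)] [∀ e, Finite (ψ.EdgeFiber e)] (e : 𝒢.graph.Edge) :
    (𝒢.coveringObj hψ hG').T e = 𝒢.fiberObjE ψ e := rfl

/-- The gluing isomorphisms of `coveringObj` are the branch-bijection reindexings.
[cite: MochizukiSemiAnbd2006, Def. 2.2(i) p.23] -/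
theorem coveringObj_ψ (hψ : SemiGraph.IsExcision ψ) (hG' : G'.IsGraph)
    [∀ v, Finite (ψ.VertexFiber v)] [∀ e, Finite (ψ.EdgeFiber e)]
    (b : 𝒢.graph.Branch) (v : 𝒢.graph.Vertex) (h : 𝒢.graph.abuts b = some v) :
    (𝒢.coveringObj hψ hG').ψ b v h = 𝒢.coveringGluing hψ hG' b v h := rfl

/-- The summand inclusion of `T_e` over a sheet `e'`, seen through the gluing `ψ_b`: it is `b^*` of
the summand inclusion of `S_v` over the vertex `v'` carrying the branch over `b` on `e'`
(compatibility of sheets along branches — the statement consumed when `𝒢 ×_𝔾 𝔾' → 𝒢` is identified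
with the covering attached to `coveringObj`). [cite: MochizukiSemiAnbd2006, Def. 2.2(i) p.23] -/
theorem map_ι_comp_coveringGluing_hom (hψ : SemiGraph.IsExcision ψ) (hG' : G'.IsGraph)
    (b : 𝒢.graph.Branch) (v : 𝒢.graph.Vertex) (h : 𝒢.graph.abuts b = some v)
    [Finite (ψ.VertexFiber v)] [Finite (ψ.EdgeFiber (𝒢.graph.edgeOf b))] (v' : ψ.VertexFiber v) :
    (𝒢.pull b v h).pullback.map (Sigma.ι (fun _ : ψ.VertexFiber v => ⊤_ (𝒢.V v)) v') ≫
        (𝒢.coveringGluing hψ hG' b v h).hom =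
      (PreservesTerminal.iso (𝒢.pull b v h).pullback).hom ≫
        Sigma.ι (fun _ : ψ.EdgeFiber (𝒢.graph.edgeOf b) => ⊤_ (𝒢.E (𝒢.graph.edgeOf b)))
          (SemiGraph.Hom.fiberEquivOfBranch hψ hG' b v h v') := by
  have h1 : (𝒢.pull b v h).pullback.map (Sigma.ι (fun _ : ψ.VertexFiber v => ⊤_ (𝒢.V v)) v') ≫
      (PreservesCoproduct.iso (𝒢.pull b v h).pullback
        (fun _ : ψ.VertexFiber v => ⊤_ (𝒢.V v))).hom =
      Sigma.ι (fun _ : ψ.VertexFiber v => (𝒢.pull b v h).pullback.obj (⊤_ (𝒢.V v))) v' := by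
    rw [← ι_comp_sigmaComparison, Category.assoc, ← PreservesCoproduct.inv_hom, Iso.inv_hom_id,
      Category.comp_id]
  have h3 : Sigma.ι (fun _ : ψ.VertexFiber v => ⊤_ (𝒢.E (𝒢.graph.edgeOf b))) v' ≫
      (Sigma.reindex (SemiGraph.Hom.fiberEquivOfBranch hψ hG' b v h)
        (fun _ : ψ.EdgeFiber (𝒢.graph.edgeOf b) => ⊤_ (𝒢.E (𝒢.graph.edgeOf b)))).hom =
      Sigma.ι (fun _ : ψ.EdgeFiber (𝒢.graph.edgeOf b) => ⊤_ (𝒢.E (𝒢.graph.edgeOf b)))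
        (SemiGraph.Hom.fiberEquivOfBranch hψ hG' b v h v') :=
    Sigma.ι_reindex_hom (SemiGraph.Hom.fiberEquivOfBranch hψ hG' b v h)
      (fun _ : ψ.EdgeFiber (𝒢.graph.edgeOf b) => ⊤_ (𝒢.E (𝒢.graph.edgeOf b))) v'
  unfold coveringGluing
  rw [Iso.trans_hom, Iso.trans_hom, ← Category.assoc, h1, ← Category.assoc, Sigma.ι_mapIso_hom,
    Category.assoc, h3]

end SemiGraphOfAnabelioids

end Literature.AnabelianGeometry.SemiGraphs
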